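import Summits.AtomisticToContinuum.Crystallization.Theses.PhononSlackCertificates
import Summits.AtomisticToContinuum.Crystallization.Theorems.PhononSlackCertificatesHullBridgeOfGluing
import Summits.AtomisticToContinuum.Crystallization.Theorems.ReggeStarCoercivityDefectFreeCrystallizesLayeredGluing

/-!
# `HullBridge` (route `PhononSlackCertificates`, crux item stmt-AtomisticToContinuum-15147) — closing file of line `Sketch`

`HullBridge = (CoerciveTwoShellGap → NearFieldConvexity → layered windows of every Lennard-Jones ground-state
sequence)`. Line `Sketch` (card `exact-hull-rigidity`) reduced it in the tree to the potential-free gluing lemma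
`PrestressSplitKorn.LayeredGluing` (`HullBridgeExact.hullBridge_of_layeredGluing`, composition of the landed soft
stubs S1 bad fraction, S2 non-layered fraction, S3 clean centres, S5 windows-of-gluing), and the gluing lemma is the
theorem `PrestressSplitKorn.stub_layeredGluing` of the sibling line `prestress-split-korn` (crux
`DefectFreeCrystallizes`): compactness in the local matching topology + exact local-to-global rigidity of box-layered
sets. This file is the one-line composition; it closes the crux item by name.
-/

noncomputable section

namespace Summit.AtomisticToContinuum.Crystallization.Theorems.HullBridgeExact

/-- **`HullBridge` holds**: `CoerciveTwoShellGap → NearFieldConvexity →` every sequence of Lennard-Jones ground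
states has layered windows at every scale (one in-layer spacing `a ∈ [47/50, 1]`; for every `R, ε`, frequently in
`N`, a rigid motion of `x N` is two-way `ε`-matched on `B(0, R)` with triangular layers in hole registry along a
Hägg word with interlayer spacings in `[39a/50, 17a/20]`). Proof: the gluing lemma `LayeredGluing`
(`PrestressSplitKorn.stub_layeredGluing`) fed into the line's landed reduction `hullBridge_of_layeredGluing`. -/
theorem hullBridge_proof :
    Summit.AtomisticToContinuum.Crystallization.Theses.PhononSlackCertificates.HullBridge :=
  hullBridge_of_layeredGluing PrestressSplitKorn.stub_layeredGluing

end Summit.AtomisticToContinuum.Crystallization.Theorems.HullBridgeExact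

end
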